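import Mathlib
import Literature.Computability.AlgebraicComplexity.OrbitClosureProofs
import Summits.ValiantsHypothesis.ValiantsHypothesis.Theorems.CutBites.Negative.LeftSLInvariantsDetPow

/-!
# The determinant map on pencils of ternary linear forms: coefficients, smoothness, lines

Crux `ValuativeGCT.ValuativeFlip` (stmt-ValiantsHypothesis-12624), wall-breaker axis 14
("plethysm tables, small cases certified"), gen 1: row 3 of the few-row table
(ternary forms are border-determinantal) — the analytic preliminaries, independent of the
tridiagonal pencil.

* `detCoeffMap n : (Fin 3 × Fin (n+1) × Fin (n+1) → ℂ) → (degIdx3 n → ℂ)`, the coefficient vector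
  of `det (x A₀ + y A₁ + z A₂)` (a ternary form of degree `n + 1`, `isHomogeneous_det_pencilOf`),
  is `C¹` (`contDiff_detCoeffMap`: its coordinates are polynomials, by the Leibniz expansion);
* `det` is affine along single-entry lines with slope the cofactor
  (`det_pencilOf_add_smul_single`, Mathlib `det_updateRow_add` + `adjugate_apply`), so the
  differential on `E_{t,i,j}` is `coeffVec3 (X_t · adj_{j i})` (`fderiv_apply_of_affine_line`);
* pushed forward to three letters `ℓ` of `MatIdx (n+1)`, `det (pencil A)` is the linear
  substitution `liftParam ℓ A · det_{n+1}` (`aeval_det_pencilOf_eq_linSubst`), hence lies in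
  `Δ(det_{n+1})` (`aeval_det_pencilOf_mem_orbitClosure`, registered stub);
* the coefficients of the pushed-forward form `formOf w (X_ℓ)` are linear, hence analytic, in `w`
  (`analyticAt_coeff_aeval_formOf`) — the test functions of `mem_orbitClosure_iff` are analytic.

The submersion at the tridiagonal Toeplitz pencil and the identity-theorem argument are in
`…TernaryFormsBorderDeterminantal`.

References: folklore (Jacobi's formula); Mathlib `Matrix.det_apply'`, `ContDiff.sum`, `contDiff_prod`,
`HasFDerivAt.comp_hasDerivAt`, `HasDerivAt.unique`, `AnalyticAt`.
-/

set_option linter.dupNamespace false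

namespace Summit.ValiantsHypothesis.ValiantsHypothesis.Theorems.ValuativeFlip

open MvPolynomial
open scoped BigOperators Matrix Topology
open Literature.NumberTheory.DiophantineGeometry Literature.Computability.AlgebraicComplexity

noncomputable section


/-! ## Coefficient vectors of ternary forms of degree `n + 1` -/

/-- The degree-`(n+1)` exponents in three variables (a `Finset`, used as a finite index type).
[this crux] -/
def degIdx3 (n : ℕ) : Finset (Fin 3 →₀ ℕ) :=
  (Finset.univ : Finset (Fin 3)).finsuppAntidiag (n + 1)

/-- Membership in `degIdx3 n`: total degree `n + 1`. [this crux] -/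
theorem mem_degIdx3 {n : ℕ} {e : Fin 3 →₀ ℕ} : e ∈ degIdx3 n ↔ Finsupp.weight 1 e = n + 1 := by
  rw [degIdx3, Finset.mem_finsuppAntidiag, Finsupp.weight_apply, Finsupp.sum_fintype _ _ (by simp)]
  simp

/-- The parameter space of pencils `x A₀ + y A₁ + z A₂` of `(n+1) × (n+1)` complex matrices.
[this crux] -/
abbrev PencilParam (n : ℕ) : Type := Fin 3 × Fin (n + 1) × Fin (n + 1) → ℂ

/-- The coefficient space of ternary forms of degree `n + 1`. [this crux] -/
abbrev FormCoeffs (n : ℕ) : Type := ↥(degIdx3 n) → ℂ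

/-- Coefficient vector (in degree `n + 1`) of a polynomial of `ℂ[x, y, z]`, a linear map. [this crux] -/
def coeffVec3 (n : ℕ) : MvPolynomial (Fin 3) ℂ →ₗ[ℂ] FormCoeffs n where
  toFun f e := coeff e.1 f
  map_add' f g := by funext e; simp
  map_smul' c f := by funext e; simp

/-- Unfolding lemma. [this crux] -/
@[simp] theorem coeffVec3_apply {n : ℕ} (f : MvPolynomial (Fin 3) ℂ) (e : ↥(degIdx3 n)) :
    coeffVec3 n f e = coeff e.1 f := rfl

/-- The form with a given coefficient vector. [this crux] -/
def formOf {n : ℕ} (w : FormCoeffs n) : MvPolynomial (Fin 3) ℂ :=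
  ∑ e : ↥(degIdx3 n), w e • monomial e.1 (1 : ℂ)

/-- `formOf w` is a form of degree `n + 1`. [this crux] -/
theorem formOf_mem_homogeneousSubmodule {n : ℕ} (w : FormCoeffs n) :
    formOf w ∈ homogeneousSubmodule (Fin 3) ℂ (n + 1) := by
  refine Submodule.sum_mem _ fun e _ => Submodule.smul_mem _ _ ?_
  refine isHomogeneous_monomial _ ?_
  rw [Finsupp.degree_eq_weight_one]
  exact mem_degIdx3.mp e.2

/-- Coefficients of `formOf w`. [this crux] -/
theorem coeff_formOf {n : ℕ} (w : FormCoeffs n) (d : Fin 3 →₀ ℕ) :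
    coeff d (formOf w) = if h : d ∈ degIdx3 n then w ⟨d, h⟩ else 0 := by
  classical
  rw [formOf, coeff_sum]
  simp only [coeff_smul, coeff_monomial, smul_eq_mul, mul_ite, mul_one, mul_zero]
  split_ifs with h
  · rw [Finset.sum_eq_single ⟨d, h⟩]
    · simp
    · intro e _ hne
      rw [if_neg]
      intro hed
      exact hne (Subtype.ext hed)
    · intro hh; exact absurd (Finset.mem_univ _) hh
  · refine Finset.sum_eq_zero fun e _ => ?_
    rw [if_neg]
    intro hed
    exact h (hed ▸ e.2)

/-- `coeffVec3 (formOf w) = w`. [this crux] -/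
theorem coeffVec3_formOf {n : ℕ} (w : FormCoeffs n) : coeffVec3 n (formOf w) = w := by
  funext e
  rw [coeffVec3_apply, coeff_formOf, dif_pos e.2]

/-- A form of degree `n + 1` is recovered from its coefficient vector. [this crux] -/
theorem formOf_coeffVec3 {n : ℕ} {f : MvPolynomial (Fin 3) ℂ} (hf : f.IsHomogeneous (n + 1)) :
    formOf (coeffVec3 n f) = f := by
  ext d
  rw [coeff_formOf]
  split_ifs with h
  · rfl
  · rw [eq_comm]
    by_contra hne
    exact h (mem_degIdx3.mpr (hf hne))

/-! ## The determinant map on pencils and its expansion -/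

/-- The pencil `x A₀ + y A₁ + z A₂` as a matrix over `ℂ[x, y, z]`. [this crux] -/
def pencilOf {n : ℕ} (A : PencilParam n) : Matrix (Fin (n + 1)) (Fin (n + 1)) (MvPolynomial (Fin 3) ℂ) :=
  Matrix.of fun i j => ∑ t : Fin 3, C (A (t, i, j)) * X t

/-- The determinant map `Φ : A ↦ (coefficients of det(x A₀ + y A₁ + z A₂))`. [this crux] -/
def detCoeffMap (n : ℕ) (A : PencilParam n) : FormCoeffs n :=
  coeffVec3 n (pencilOf A).det

/-- The entries of a pencil are linear forms. [this crux] -/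
theorem isHomogeneous_pencilOf_apply {n : ℕ} (A : PencilParam n) (i j : Fin (n + 1)) :
    (pencilOf A i j).IsHomogeneous 1 := by
  rw [pencilOf, Matrix.of_apply]
  exact IsHomogeneous.sum _ _ _ fun t _ => (isHomogeneous_X ℂ t).C_mul _

/-- `det` of a pencil of size `n + 1` is a ternary form of degree `n + 1`. [folklore] -/
theorem isHomogeneous_det_pencilOf {n : ℕ} (A : PencilParam n) :
    ((pencilOf A).det).IsHomogeneous (n + 1) := by
  rw [Matrix.det_apply']
  refine IsHomogeneous.sum _ _ _ fun σ _ => ?_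
  have hprod : (∏ i, pencilOf A (σ i) i).IsHomogeneous (∑ i : Fin (n + 1), 1) :=
    IsHomogeneous.prod _ _ _ fun i _ => isHomogeneous_pencilOf_apply A (σ i) i
  rw [Finset.sum_const, Finset.card_univ, Fintype.card_fin, smul_eq_mul, mul_one] at hprod
  have hε : ((Equiv.Perm.sign σ : ℤ) : MvPolynomial (Fin 3) ℂ) = C ((Equiv.Perm.sign σ : ℤ) : ℂ) := by
    rw [map_intCast]
  rw [hε]
  exact hprod.C_mul _

/-- `formOf (Φ A) = det (pencil A)`. [this crux] -/
theorem formOf_detCoeffMap {n : ℕ} (A : PencilParam n) :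
    formOf (detCoeffMap n A) = (pencilOf A).det :=
  formOf_coeffVec3 (isHomogeneous_det_pencilOf A)

/-- Leibniz expansion of `det (pencil A)` as an explicit combination of monomials whose
coefficients are polynomial (multilinear) in the parameters. [folklore] -/
theorem det_pencilOf_eq {n : ℕ} (A : PencilParam n) :
    (pencilOf A).det = ∑ σ : Equiv.Perm (Fin (n + 1)), ∑ τ : Fin (n + 1) → Fin 3,
      C (((Equiv.Perm.sign σ : ℤ) : ℂ) * ∏ i, A (τ i, σ i, i)) * ∏ i, (X (τ i) : MvPolynomial (Fin 3) ℂ) := by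
  rw [Matrix.det_apply']
  refine Finset.sum_congr rfl fun σ _ => ?_
  have hprod : (∏ i, pencilOf A (σ i) i) = ∑ τ : Fin (n + 1) → Fin 3,
      C (∏ i, A (τ i, σ i, i)) * ∏ i, (X (τ i) : MvPolynomial (Fin 3) ℂ) := by
    simp only [pencilOf, Matrix.of_apply]
    rw [Finset.prod_univ_sum]
    refine Finset.sum_congr rfl fun τ _ => ?_
    rw [Finset.prod_mul_distrib, map_prod]
  rw [hprod, Finset.mul_sum]
  refine Finset.sum_congr rfl fun τ _ => ?_
  rw [map_mul, ← map_intCast (C : ℂ →+* MvPolynomial (Fin 3) ℂ)]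
  ring

/-- Coordinates of `Φ`: polynomial functions of the parameters. [this crux] -/
theorem detCoeffMap_apply_eq {n : ℕ} (A : PencilParam n) (e : ↥(degIdx3 n)) :
    detCoeffMap n A e = ∑ σ : Equiv.Perm (Fin (n + 1)), ∑ τ : Fin (n + 1) → Fin 3,
      (((Equiv.Perm.sign σ : ℤ) : ℂ) * ∏ i, A (τ i, σ i, i)) *
        coeff e.1 (∏ i, (X (τ i) : MvPolynomial (Fin 3) ℂ)) := by
  rw [detCoeffMap, coeffVec3_apply, det_pencilOf_eq, coeff_sum]
  refine Finset.sum_congr rfl fun σ _ => ?_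
  rw [coeff_sum]
  refine Finset.sum_congr rfl fun τ _ => ?_
  rw [coeff_C_mul]

/-- **`Φ` is continuously differentiable** (its coordinates are polynomials). [folklore] -/
theorem contDiff_detCoeffMap (n : ℕ) : ContDiff ℂ 1 (detCoeffMap n) := by
  rw [contDiff_pi]
  intro e
  have hfun : (fun A : PencilParam n => detCoeffMap n A e) = fun A =>
      ∑ σ : Equiv.Perm (Fin (n + 1)), ∑ τ : Fin (n + 1) → Fin 3,
        (((Equiv.Perm.sign σ : ℤ) : ℂ) * ∏ i, A (τ i, σ i, i)) *
          coeff e.1 (∏ i, (X (τ i) : MvPolynomial (Fin 3) ℂ)) := by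
    funext A
    exact detCoeffMap_apply_eq A e
  rw [hfun]
  refine ContDiff.sum fun σ _ => ContDiff.sum fun τ _ => ?_
  refine ContDiff.mul (ContDiff.mul contDiff_const ?_) contDiff_const
  exact contDiff_prod fun i _ => contDiff_apply ℂ ℂ (τ i, σ i, i)

/-! ## Single-entry lines: `det` is affine with slope the cofactor -/

/-- Perturbing one entry of one pencil matrix: `pencil (A + u E_{t,i,j})` is `pencil A` with
`u X_t` added in position `(i, j)`. [this crux] -/
theorem pencilOf_add_smul_single {n : ℕ} (A : PencilParam n) (u : ℂ) (t : Fin 3)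
    (i j : Fin (n + 1)) :
    pencilOf (A + u • Pi.single (t, i, j) (1 : ℂ)) =
      (pencilOf A).updateRow i ((pencilOf A) i + (C u * X t) • Pi.single j (1 : MvPolynomial (Fin 3) ℂ)) := by
  classical
  refine Matrix.ext fun r s => ?_
  rw [Matrix.updateRow_apply]
  simp only [pencilOf, Matrix.of_apply, Pi.add_apply, Pi.smul_apply, map_add, add_mul,
    Finset.sum_add_distrib, smul_eq_mul]
  have hsingle : ∀ t' : Fin 3, (Pi.single (t, i, j) (1 : ℂ) : PencilParam n) (t', r, s) =
      if t' = t ∧ r = i ∧ s = j then 1 else 0 := by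
    intro t'
    rw [Pi.single_apply]
    simp only [Prod.mk.injEq]
  simp only [hsingle]
  by_cases hr : r = i
  · subst hr
    rw [if_pos rfl]
    simp only [true_and, Pi.single_apply, mul_ite, mul_one, mul_zero]
    congr 1
    by_cases hs : s = j
    · subst hs
      rw [if_pos rfl, Finset.sum_eq_single t]
      · simp
      · intro t' _ ht'; simp [ht']
      · intro h; exact absurd (Finset.mem_univ _) h
    · rw [if_neg hs]
      refine Finset.sum_eq_zero fun t' _ => ?_
      simp [hs]
  · rw [if_neg hr]
    have hzero : ∑ t' : Fin 3, C (u * if t' = t ∧ r = i ∧ s = j then (1 : ℂ) else 0) *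
        (X t' : MvPolynomial (Fin 3) ℂ) = 0 := by
      refine Finset.sum_eq_zero fun t' _ => ?_
      simp [hr]
    rw [hzero, add_zero]

/-- **`det` is affine along single-entry lines**, with slope the cofactor:
`det (pencil (A + u E_{t,i,j})) = det (pencil A) + u X_t adj(pencil A)_{j i}`. [folklore] -/
theorem det_pencilOf_add_smul_single {n : ℕ} (A : PencilParam n) (u : ℂ) (t : Fin 3)
    (i j : Fin (n + 1)) :
    (pencilOf (A + u • Pi.single (t, i, j) (1 : ℂ))).det =
      (pencilOf A).det + C u * X t * (pencilOf A).adjugate j i := by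
  rw [pencilOf_add_smul_single, Matrix.det_updateRow_add, Matrix.updateRow_eq_self,
    Matrix.det_updateRow_smul, Matrix.adjugate_apply]

/-- The same, on coefficient vectors: `Φ (A + u E_{t,i,j}) = Φ A + u · coeffVec3 (X_t adj_{j i})`.
[this crux] -/
theorem detCoeffMap_add_smul_single {n : ℕ} (A : PencilParam n) (u : ℂ) (t : Fin 3)
    (i j : Fin (n + 1)) :
    detCoeffMap n (A + u • Pi.single (t, i, j) (1 : ℂ)) =
      detCoeffMap n A + u • coeffVec3 n (X t * (pencilOf A).adjugate j i) := by
  rw [detCoeffMap, det_pencilOf_add_smul_single, map_add, mul_assoc, ← smul_eq_C_mul, map_smul]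
  rfl

/-- Directional derivatives of a differentiable map along affine lines. [folklore] -/
theorem fderiv_apply_of_affine_line {n : ℕ} (A v : PencilParam n) (w : FormCoeffs n)
    (h : ∀ u : ℂ, detCoeffMap n (A + u • v) = detCoeffMap n A + u • w) :
    fderiv ℂ (detCoeffMap n) A v = w := by
  have hd : HasFDerivAt (detCoeffMap n) (fderiv ℂ (detCoeffMap n) A) A :=
    (((contDiff_detCoeffMap n).differentiable one_ne_zero) A).hasFDerivAt
  have hγ : HasDerivAt (fun u : ℂ => A + u • v) v 0 := by
    simpa using ((hasDerivAt_id (0 : ℂ)).smul_const v).const_add A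
  have h0 : (fun u : ℂ => A + u • v) 0 = A := by simp
  have hd' : HasFDerivAt (detCoeffMap n) (fderiv ℂ (detCoeffMap n) A) ((fun u : ℂ => A + u • v) 0) := by
    rw [h0]; exact hd
  have hcomp := hd'.comp_hasDerivAt (0 : ℂ) hγ
  have hline : HasDerivAt (fun u : ℂ => detCoeffMap n A + u • w) w 0 := by
    simpa using ((hasDerivAt_id (0 : ℂ)).smul_const w).const_add (detCoeffMap n A)
  have hfun : (detCoeffMap n ∘ fun u : ℂ => A + u • v) = fun u : ℂ => detCoeffMap n A + u • w := by
    funext u; exact h u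
  rw [hfun] at hcomp
  exact hcomp.unique hline


/-! ## Pushing ternary pencils into the matrix variables -/

/-- The substitution matrix realising the pencil `A` on three letters `ℓ 0, ℓ 1, ℓ 2` of
`MatIdx (n+1)`: `X_{(i,j)} ↦ ∑_t A(t,i,j) X_{ℓ t}`. [this crux] -/
def liftParam {n : ℕ} (ℓ : Fin 3 → MatIdx (n + 1)) (A : PencilParam n) :
    Matrix (MatIdx (n + 1)) (MatIdx (n + 1)) ℂ :=
  fun l p => ∑ t : Fin 3, if ℓ t = l then A (t, (ofLex p).1, (ofLex p).2) else 0

/-- `linSubst (liftParam ℓ A)` on a variable. [this crux] -/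
theorem linSubst_liftParam_X {n : ℕ} (ℓ : Fin 3 → MatIdx (n + 1)) (A : PencilParam n)
    (i j : Fin (n + 1)) :
    linSubst (MatIdx (n + 1)) ℂ (liftParam ℓ A) (X (toLex (i, j))) =
      ∑ t : Fin 3, A (t, i, j) • (X (ℓ t) : MvPolynomial (MatIdx (n + 1)) ℂ) := by
  classical
  rw [linSubst_X]
  simp only [liftParam, ofLex_toLex, Finset.sum_smul, ite_smul, zero_smul]
  rw [Finset.sum_comm]
  refine Finset.sum_congr rfl fun t _ => ?_
  rw [Finset.sum_ite_eq, if_pos (Finset.mem_univ _)]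

/-- **The pushed-forward determinant of a pencil is a linear substitution of `det_m`**:
`(det (pencil A))(X_{ℓ 0}, X_{ℓ 1}, X_{ℓ 2}) = liftParam ℓ A · det_{n+1}`. [this crux] -/
theorem aeval_det_pencilOf_eq_linSubst {n : ℕ} (ℓ : Fin 3 → MatIdx (n + 1)) (A : PencilParam n) :
    aeval (fun t => (X (ℓ t) : MvPolynomial (MatIdx (n + 1)) ℂ)) (pencilOf A).det =
      linSubst (MatIdx (n + 1)) ℂ (liftParam ℓ A) (detFormLex ℂ (n + 1)) := by
  rw [CutBites.Negative.detFormLex_eq_det_of, AlgHom.map_det, AlgHom.map_det]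
  congr 1
  refine Matrix.ext fun i j => ?_
  rw [AlgHom.mapMatrix_apply, Matrix.map_apply, AlgHom.mapMatrix_apply, Matrix.map_apply,
    Matrix.of_apply, linSubst_liftParam_X, pencilOf, Matrix.of_apply, map_sum]
  refine Finset.sum_congr rfl fun t _ => ?_
  rw [map_mul, aeval_C, aeval_X, smul_eq_C_mul]
  rfl

/-- Hence it lies in `Δ(det_{n+1})` (endomorphism orbit ⊆ orbit closure). [this crux] -/
theorem aeval_det_pencilOf_mem_orbitClosure : ∀ (n : ℕ) (ℓ : Fin 3 → MatIdx (n + 1)) (A : PencilParam n), MvPolynomial.aeval (fun t => (MvPolynomial.X (ℓ t) : MvPolynomial (MatIdx (n + 1)) ℂ)) (pencilOf A).det ∈ orbitClosure (detFormLex ℂ (n + 1)) := by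
  intro n ℓ A
  classical
  rw [aeval_det_pencilOf_eq_linSubst]
  exact endOrbit_subset_orbitClosure_holds _ ⟨_, rfl⟩

/-! ## The test functions are analytic in the coefficients -/

/-- Each coefficient of the pushed-forward form `formOf w (X_{ℓ 0}, X_{ℓ 1}, X_{ℓ 2})` is a linear,
hence analytic, function of `w`. [this crux] -/
theorem analyticAt_coeff_aeval_formOf {n : ℕ} (ℓ : Fin 3 → MatIdx (n + 1))
    (d : MatIdx (n + 1) →₀ ℕ) (z : FormCoeffs n) :
    AnalyticAt ℂ (fun w : FormCoeffs n =>
      coeff d (aeval (fun t => (X (ℓ t) : MvPolynomial (MatIdx (n + 1)) ℂ)) (formOf w))) z := by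
  have hfun : (fun w : FormCoeffs n =>
      coeff d (aeval (fun t => (X (ℓ t) : MvPolynomial (MatIdx (n + 1)) ℂ)) (formOf w))) =
      fun w => ∑ e : ↥(degIdx3 n), w e *
        coeff d (aeval (fun t => (X (ℓ t) : MvPolynomial (MatIdx (n + 1)) ℂ)) (monomial e.1 (1 : ℂ))) := by
    funext w
    simp only [formOf, map_sum, map_smul, coeff_sum, coeff_smul, smul_eq_mul]
  rw [hfun]
  refine Finset.analyticAt_fun_sum _ fun e _ => ?_
  exact ((ContinuousLinearMap.proj (R := ℂ) (φ := fun _ : ↥(degIdx3 n) => ℂ) e).analyticAt z).mul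
    analyticAt_const

end

end Summit.ValiantsHypothesis.ValiantsHypothesis.Theorems.ValuativeFlip
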